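import Literature.MathematicalPhysics.QuantumFieldTheory.Balaban1983to89.BlockAveragingSectionPlaq
import Literature.MathematicalPhysics.QuantumFieldTheory.Balaban1983to89.BlockAveragingFederbushGValued
import HarnessLib

/-!
# Route `UnitScaleTilt`, crux K1 child «MinimiserStabilityRegPr» (stmt-QuantumFields-19200), stub `stub_smoothLift` (G-K1a-2′) —
# DEFINITIONS: the SMOOTH INTERPOLATION `interp V` of a small coarse `SU(2)` field through one block-averaging step

Fleet seat `ym-ust-19200-p2` (gen 0).  The located content of G-K1a-2′ (`T3UpperLiftSplit.SmoothLiftAt`, smooth regime `b < a`) is an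
APPROXIMATE one-step lift carrying `1/L` of the Wilson action, to be corrected to an EXACT lift by the tree's correctors
(`BlockAvgCorrector.exists_corrector_T3`, `SmoothLiftCorrection.exists_exact_lift_of_loops`).  This file DEFINES that approximate
lift and nothing else (estimates are in the sibling proof files).

THE OBJECT (reader's construction; abelian template [King1986] (A.5), mechanism [Balaban1985Averaging] §C).  For a coarse field `V` on
`T^{(j+1)}` and a coarse site `y` let `F_{κλ}(y) = log V(∂p_{κλ}(y)) ∈ 𝔰𝔲(2)` be the logarithm of the plaquette variable at `y`
(`curv`, guarded: `0` unless `|V(∂p) − 1| ≤ 1/3`; antisymmetric in `κ, λ`).  On the block `B(y)` (centre `emb y`, centred offsets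
`n_ν(x) = (x_ν mod L) − (L−1)/2 ∈ {−(L−1)/2, …, (L−1)/2}`, `coff`) the SYMMETRIC-GAUGE CONSTANT-CURVATURE MODEL has the potential
`B_λ(x) = (2L²)⁻¹ Σ_ρ n_ρ(x) F_{ρλ}(y)` (`pot`; its lattice curl is `F_{κλ}(y)/L²` exactly at first order), and the interpolation is
  `interp V (x, x + e_λ) = exp(s·B_λ(x)) · faceSec V (x, x + e_λ)`,   `s = L + 1` if the bond exits its block, `s = 1` otherwise
(`wt`), `faceSec V` the tree's face section (`V(⟨y, λ⟩)` on exiting bonds, `1` inside blocks).  The weight `L + 1` on the exiting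
bonds is the transition function between the symmetric gauges of adjacent blocks (`e^{L·B_λ}`, a linear phase across the face)
merged with the model factor `e^{B_λ}`; with it EVERY fine plaquette at a site of `B(y)` — interior, face, edge — is
`exp(F_{κλ}(y)/L² + O(|∇F| + |F|²))`, and the straight transporters are `V` exactly (`B_μ = 0` on the axis of direction `μ`).
[cite: King1986, (A.5) p.676; Balaban1987RG1, (0.3)-(0.4) p.252]
-/

noncomputable section

open NormedSpace
open scoped Matrix.Norms.L2Operator BigOperators

namespace Summit.QuantumFields.YangMills.Theorems.SmoothLiftInterp

open Literature.MathematicalPhysics.QuantumFieldTheory.Balaban1983to89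
open MatrixLog T4Continuum AveragingRT BlockAveraging BlockAveragingSection BlockAveragingSectionPlaq

variable {P : Params} {j : ℕ}

/-! ## §1 The coarse curvature `F_{κλ}(y) = log V(∂p)` -/

/-- The plaquette variable of `V` at the coarse site `y` in the ORDERED pair of directions `(κ, λ)`:
`V(y,y+e_κ) V(y+e_κ,y+e_κ+e_λ) V(y+e_λ,y+e_κ+e_λ)⁻¹ V(y,y+e_λ)⁻¹` (for `κ < λ` the tree's `plaqHol`; `1` for `κ = λ`; the inverse for
`(λ, κ)`). [cite: Balaban1985Averaging, (9) p.19] -/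
def plaqElt (V : GaugeField P (j+1) (Matrix.specialUnitaryGroup (Fin 2) ℂ)) (y : Site P (j+1)) (κ μ : Fin P.d) :
    Matrix.specialUnitaryGroup (Fin 2) ℂ :=
  V ⟨y, κ⟩ * V ⟨y.shift κ, μ⟩ * (V ⟨y.shift μ, κ⟩)⁻¹ * (V ⟨y, μ⟩)⁻¹

/-- For `κ < λ` the ordered plaquette variable is the tree's `V(∂p)`, `p = ⟨y, κ, λ⟩`. [cite: Balaban1985Averaging, (9) p.19] -/
theorem plaqElt_eq_plaqHol (V : GaugeField P (j+1) (Matrix.specialUnitaryGroup (Fin 2) ℂ)) (y : Site P (j+1)) {κ μ : Fin P.d}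
    (h : κ < μ) : plaqElt V y κ μ = GaugeField.plaqHol V ⟨y, κ, μ, h⟩ := rfl

/-- `V(∂p_{κκ}) = 1`. [folklore] -/
theorem plaqElt_self (V : GaugeField P (j+1) (Matrix.specialUnitaryGroup (Fin 2) ℂ)) (y : Site P (j+1)) (κ : Fin P.d) :
    plaqElt V y κ κ = 1 := by
  unfold plaqElt; group

/-- Reversing the orientation inverts the plaquette variable: `V(∂p_{λκ}) = V(∂p_{κλ})⁻¹`. [cite: Balaban1985Averaging, (9) p.19] -/
theorem plaqElt_swap (V : GaugeField P (j+1) (Matrix.specialUnitaryGroup (Fin 2) ℂ)) (y : Site P (j+1)) (κ μ : Fin P.d) :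
    plaqElt V y μ κ = (plaqElt V y κ μ)⁻¹ := by
  unfold plaqElt; group

open scoped Classical in
/-- **THE COARSE CURVATURE** `F_{κλ}(y) = log V(∂p_{κλ}(y))` (series = principal logarithm), GUARDED: `0` unless `|V(∂p) − 1| ≤ 1/3`
(so that it always lies in `𝔰𝔲(2)`; on the small fields of G-K1a-2′ the guard is on). [cite: Balaban1985Averaging, (23) p.21] -/
def curv (V : GaugeField P (j+1) (Matrix.specialUnitaryGroup (Fin 2) ℂ)) (y : Site P (j+1)) (κ μ : Fin P.d) : Matrix (Fin 2) (Fin 2) ℂ :=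
  if ‖((plaqElt V y κ μ : Matrix.specialUnitaryGroup (Fin 2) ℂ) : Matrix (Fin 2) (Fin 2) ℂ) - 1‖ ≤ 1 / 3 then
    mlog ((plaqElt V y κ μ : Matrix.specialUnitaryGroup (Fin 2) ℂ) : Matrix (Fin 2) (Fin 2) ℂ) else 0

/-- On the guard the curvature is the logarithm of the plaquette variable. [cite: Balaban1985Averaging, (23) p.21] -/
theorem curv_of_small {V : GaugeField P (j+1) (Matrix.specialUnitaryGroup (Fin 2) ℂ)} {y : Site P (j+1)} {κ μ : Fin P.d}
    (h : ‖((plaqElt V y κ μ : Matrix.specialUnitaryGroup (Fin 2) ℂ) : Matrix (Fin 2) (Fin 2) ℂ) - 1‖ ≤ 1 / 3) :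
    curv V y κ μ = mlog ((plaqElt V y κ μ : Matrix.specialUnitaryGroup (Fin 2) ℂ) : Matrix (Fin 2) (Fin 2) ℂ) := by
  unfold curv; rw [if_pos h]

/-- Off the guard the curvature is `0`. [folklore] -/
theorem curv_of_not_small {V : GaugeField P (j+1) (Matrix.specialUnitaryGroup (Fin 2) ℂ)} {y : Site P (j+1)} {κ μ : Fin P.d}
    (h : ¬ ‖((plaqElt V y κ μ : Matrix.specialUnitaryGroup (Fin 2) ℂ) : Matrix (Fin 2) (Fin 2) ℂ) - 1‖ ≤ 1 / 3) :
    curv V y κ μ = 0 := by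
  unfold curv; rw [if_neg h]

/-- The coarse curvature lies in `𝔰𝔲(2)` (the tree's `(specialUnitaryLogChart (Fin 2)).lie`). [cite: Balaban1985Averaging, (23) p.21] -/
theorem curv_mem_lie (V : GaugeField P (j+1) (Matrix.specialUnitaryGroup (Fin 2) ℂ)) (y : Site P (j+1)) (κ μ : Fin P.d) :
    curv V y κ μ ∈ (specialUnitaryLogChart (Fin 2)).lie := by
  by_cases h : ‖((plaqElt V y κ μ : Matrix.specialUnitaryGroup (Fin 2) ℂ) : Matrix (Fin 2) (Fin 2) ℂ) - 1‖ ≤ 1 / 3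
  · rw [curv_of_small h]
    refine (specialUnitaryLogChart (Fin 2)).mlog_mem (plaqElt V y κ μ).2 ?_
    rw [specialUnitaryLogChart_ρ, Fintype.card_fin]
    exact le_min h (h.trans (by norm_num))
  · rw [curv_of_not_small h]; exact Submodule.zero_mem _

/-- `F_{κκ} = 0`. [folklore] -/
theorem curv_self (V : GaugeField P (j+1) (Matrix.specialUnitaryGroup (Fin 2) ℂ)) (y : Site P (j+1)) (κ : Fin P.d) :
    curv V y κ κ = 0 := by
  have h : ‖((plaqElt V y κ κ : Matrix.specialUnitaryGroup (Fin 2) ℂ) : Matrix (Fin 2) (Fin 2) ℂ) - 1‖ ≤ 1 / 3 := by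
    rw [plaqElt_self]; simp
  rw [curv_of_small h, plaqElt_self]
  exact mlog_one

/-- The inverse in `SU(2)` is the adjoint (matrix form). [folklore] -/
theorem coe_inv_su2 (g : Matrix.specialUnitaryGroup (Fin 2) ℂ) :
    ((g⁻¹ : Matrix.specialUnitaryGroup (Fin 2) ℂ) : Matrix (Fin 2) (Fin 2) ℂ) = star ((g : Matrix.specialUnitaryGroup (Fin 2) ℂ) : Matrix (Fin 2) (Fin 2) ℂ) :=
  rfl

/-- **ANTISYMMETRY** `F_{λκ} = −F_{κλ}` (`log W⁻¹ = −log W` on the guard, which is symmetric under inversion). [cite: Balaban1985Averaging, (23) p.21] -/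
theorem curv_swap (V : GaugeField P (j+1) (Matrix.specialUnitaryGroup (Fin 2) ℂ)) (y : Site P (j+1)) (κ μ : Fin P.d) :
    curv V y μ κ = -curv V y κ μ := by
  set A : Matrix (Fin 2) (Fin 2) ℂ := ((plaqElt V y κ μ : Matrix.specialUnitaryGroup (Fin 2) ℂ) : Matrix (Fin 2) (Fin 2) ℂ) with hA
  have hinv : ((plaqElt V y μ κ : Matrix.specialUnitaryGroup (Fin 2) ℂ) : Matrix (Fin 2) (Fin 2) ℂ) = star A := by
    rw [plaqElt_swap, coe_inv_su2]
  have hnorm : ‖star A - 1‖ = ‖A - 1‖ := ExpMeanLog.norm_star_sub_one A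
  have hAA : A * star A = 1 :=
    (Matrix.mem_unitaryGroup_iff.1 (Matrix.mem_specialUnitaryGroup_iff.1 (plaqElt V y κ μ).2).1)
  by_cases h : ‖A - 1‖ ≤ 1 / 3
  · have h' : ‖((plaqElt V y μ κ : Matrix.specialUnitaryGroup (Fin 2) ℂ) : Matrix (Fin 2) (Fin 2) ℂ) - 1‖ ≤ 1 / 3 := by
      rw [hinv, hnorm]; exact h
    rw [curv_of_small h', curv_of_small h, hinv]
    exact ExpMeanLog.mlog_eq_neg_of_mul_eq_one hAA h
  · have h' : ¬ ‖((plaqElt V y μ κ : Matrix.specialUnitaryGroup (Fin 2) ℂ) : Matrix (Fin 2) (Fin 2) ℂ) - 1‖ ≤ 1 / 3 := by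
      rw [hinv, hnorm]; exact h
    rw [curv_of_not_small h', curv_of_not_small h, neg_zero]

/-! ## §2 Centred offsets, the model potential, the weight, the interpolation -/

/-- **THE CENTRED OFFSET** `n_ν(x) = (x_ν mod L) − (L−1)/2 ∈ {−(L−1)/2, …, (L−1)/2}` of a fine site from the centre of its block (as a
real number; the tree's `offset x ν − (L−1)/2`, cf. `BlockAveraging.off`). [cite: Balaban1987RG1, (0.3) p.252] -/
def coff (x : Site P j) (ν : Fin P.d) : ℝ := (offset x ν : ℝ) - (((P.L - 1) / 2 : ℕ) : ℝ)

/-- **THE MODEL POTENTIAL** `B_λ(x) = (2L²)⁻¹ Σ_ρ n_ρ(x) F_{ρλ}(blockOf x)` — the symmetric-gauge potential of the constant curvature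
`F(blockOf x)/L²` on the block of `x`. [cite: King1986, (A.5) p.676] -/
def pot (V : GaugeField P (j+1) (Matrix.specialUnitaryGroup (Fin 2) ℂ)) (x : Site P j) (μ : Fin P.d) : Matrix (Fin 2) (Fin 2) ℂ :=
  (1 / (2 * (P.L : ℝ) ^ 2)) • ∑ ρ : Fin P.d, coff x ρ • curv V (blockOf x) ρ μ

/-- The model potential lies in `𝔰𝔲(2)`. [folklore] -/
theorem pot_mem_lie (V : GaugeField P (j+1) (Matrix.specialUnitaryGroup (Fin 2) ℂ)) (x : Site P j) (μ : Fin P.d) :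
    pot V x μ ∈ (specialUnitaryLogChart (Fin 2)).lie :=
  Submodule.smul_mem _ _ (Submodule.sum_mem _ fun ρ _ => Submodule.smul_mem _ _ (curv_mem_lie V _ ρ μ))

open scoped Classical in
/-- **THE WEIGHT** `s(b) = L + 1` on a bond exiting its block, `1` otherwise (the transition between the symmetric gauges of adjacent
blocks is the linear phase `e^{L·B_λ}` across the face). [cite: King1986, (A.5) p.676] -/
def wt (b : PBond P j) : ℝ := if ExitsBlock b then (P.L : ℝ) + 1 else 1

/-- `s(b) = L + 1` on an exiting bond. [folklore] -/
theorem wt_of_exits {b : PBond P j} (h : ExitsBlock b) : wt b = (P.L : ℝ) + 1 := by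
  classical
  unfold wt; rw [if_pos h]

/-- `s(b) = 1` on a non-exiting bond. [folklore] -/
theorem wt_of_not_exits {b : PBond P j} (h : ¬ ExitsBlock b) : wt b = 1 := by
  classical
  unfold wt; rw [if_neg h]

/-- The exponent `s(b)·B_λ(x)` of the interpolation lies in `𝔰𝔲(2)`. [folklore] -/
theorem wt_smul_pot_mem_lie (V : GaugeField P (j+1) (Matrix.specialUnitaryGroup (Fin 2) ℂ)) (b : PBond P j) :
    wt b • pot V b.src b.dir ∈ (specialUnitaryLogChart (Fin 2)).lie :=
  Submodule.smul_mem _ _ (pot_mem_lie V _ _)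

/-- The model factor `exp(s(b)·B_λ(x)) ∈ SU(2)` of the interpolation on the bond `b = ⟨x, x + e_λ⟩`. [cite: King1986, (A.5) p.676] -/
def modelFactor (V : GaugeField P (j+1) (Matrix.specialUnitaryGroup (Fin 2) ℂ)) (b : PBond P j) :
    Matrix.specialUnitaryGroup (Fin 2) ℂ :=
  ⟨exp (wt b • pot V b.src b.dir), (specialUnitaryLogChart (Fin 2)).exp_mem (wt_smul_pot_mem_lie V b)⟩

/-- The matrix of the model factor is `exp(s(b)·B_λ(x))`. [folklore] -/
@[simp] theorem coe_modelFactor (V : GaugeField P (j+1) (Matrix.specialUnitaryGroup (Fin 2) ℂ)) (b : PBond P j) :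
    ((modelFactor V b : Matrix.specialUnitaryGroup (Fin 2) ℂ) : Matrix (Fin 2) (Fin 2) ℂ) = exp (wt b • pot V b.src b.dir) := rfl

/-- **THE SMOOTH INTERPOLATION** of a coarse `SU(2)` field through one block-averaging step:
`interp V (b) = exp(s(b)·B_λ(x)) · faceSec V (b)` on the fine bond `b = ⟨x, x + e_λ⟩` — the symmetric-gauge constant-curvature model
of each block, glued across the faces by the tree's face section with the linear phase `e^{L·B_λ}`. [cite: King1986, (A.5) p.676] -/
def interp (V : GaugeField P (j+1) (Matrix.specialUnitaryGroup (Fin 2) ℂ)) : GaugeField P j (Matrix.specialUnitaryGroup (Fin 2) ℂ) :=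
  fun b => modelFactor V b * faceSec V b

/-- Unfolding the interpolation on a bond. [folklore] -/
theorem interp_apply (V : GaugeField P (j+1) (Matrix.specialUnitaryGroup (Fin 2) ℂ)) (b : PBond P j) :
    interp V b = modelFactor V b * faceSec V b := rfl

/-- On a bond inside a block: `interp V (b) = exp(B_λ(x))`. [cite: King1986, (A.5) p.676] -/
theorem coe_interp_of_not_exits (V : GaugeField P (j+1) (Matrix.specialUnitaryGroup (Fin 2) ℂ)) {b : PBond P j}
    (h : ¬ ExitsBlock b) :
    ((interp V b : Matrix.specialUnitaryGroup (Fin 2) ℂ) : Matrix (Fin 2) (Fin 2) ℂ) = exp (pot V b.src b.dir) := by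
  rw [interp_apply, faceSec_of_not_exits V h, mul_one, coe_modelFactor, wt_of_not_exits h, one_smul]

/-- On a bond exiting its block: `interp V (b) = exp((L+1)·B_λ(x)) · V(⟨blockOf x, λ⟩)`. [cite: King1986, (A.5) p.676] -/
theorem coe_interp_of_exits (V : GaugeField P (j+1) (Matrix.specialUnitaryGroup (Fin 2) ℂ)) {b : PBond P j} (h : ExitsBlock b) :
    ((interp V b : Matrix.specialUnitaryGroup (Fin 2) ℂ) : Matrix (Fin 2) (Fin 2) ℂ) =
      exp (((P.L : ℝ) + 1) • pot V b.src b.dir) *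
        ((V ⟨blockOf b.src, b.dir⟩ : Matrix.specialUnitaryGroup (Fin 2) ℂ) : Matrix (Fin 2) (Fin 2) ℂ) := by
  rw [interp_apply, faceSec_of_exits V h, Submonoid.coe_mul, coe_modelFactor, wt_of_exits h]

end Summit.QuantumFields.YangMills.Theorems.SmoothLiftInterp

end
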